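import Mathlib.Combinatorics.SimpleGraph.Paths
import Mathlib.Combinatorics.SimpleGraph.Walk.Decomp
import Mathlib.Combinatorics.SimpleGraph.Walk.Operations
import Literature.Probability.RandomPlanarGeometry.LoopErasure
import HarnessLib

/-!
# Mathlib's `Walk.bypass` is chronological loop erasure run backwards

Topic `Probability/RandomPlanarGeometry`; companion to `LoopErasure.lean` (Lawler's chronological
loop erasure `loopErase` on vertex lists). Pure list/walk combinatorics, everything PROVED:

* `loopErase_concat` — erasing after appending one final vertex `u`: if `u` already occurs in
  `loopErase l` the result is the prefix of `loopErase l` through `u`, otherwise `loopErase l ++ [u]`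
  (with the splitting lemmas `afterLast_concat_of_ne`, `afterLast_concat_self`);
* `support_dropUntil_eq_cons_afterLast` — on a walk with no repeated vertex,
  `(p.dropUntil u h).support = u :: afterLast u p.support`;
* `support_bypass_eq_reverse_loopErase_reverse` — **the bridge**: for every walk `ω` of a simple
  graph, `ω.bypass.support = (loopErase ω.support.reverse).reverse`, i.e. Mathlib's
  `SimpleGraph.Walk.bypass` (which erases the loops of the TAIL first) is the reversal of the
  chronological loop erasure of the reversed walk ("backward loop erasure"; cf. Lawler,
  *Intersections of Random Walks* (1991) §7.2, and the remark in `LoopErasure.lean` that `bypass`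
  and `loopErase` differ: on `0 1 0 2 1 3`, `loopErase = 0 2 1 3` while `bypass = 0 1 3`);
  `support_bypass_reverse` is the form `ω.reverse.bypass.support = (loopErase ω.support).reverse`.

Use: item `LoopErasureIdentity` of route CriticalPhenomena/SAWLoopAvoidanceChaos
(stmt-CriticalPhenomena-4526) is Lawler's loop-erased-measure formula typed with `bypass`; with this
bridge and the reversal bijection `Walk a b ≃ Walk b a` it follows from the proved chronological form
`Literature.Probability.LatticeModels.tsum_loopErase_eq_exp_rwLoopMass_holds` (candidate proof
attached to that item). No probability here.

## References

* G. F. Lawler, *Intersections of Random Walks*, Birkhäuser (1991), §7.1–7.2 (loop erasure,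
  forward vs backward erasure). [Lawler1991]
* Mathlib, `SimpleGraph.Walk.bypass` (`Mathlib/Combinatorics/SimpleGraph/Paths.lean`).
-/

namespace Literature.Probability.RandomPlanarGeometry

open SimpleGraph

section Bridge

variable {V : Type*} [DecidableEq V]

/-- Splitting off a final vertex different from `a`: the part after the last `a` of `l ++ [u]`
is the part after the last `a` of `l`, followed by `u`. [folklore] -/
theorem afterLast_concat_of_ne {a u : V} (h : u ≠ a) (l : List V) :
    afterLast a (l ++ [u]) = afterLast a l ++ [u] := by
  rw [afterLast, afterLast, List.rtakeWhile_concat]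
  simp [h]

/-- Splitting off a final vertex equal to `a`: nothing comes after the last `a` of `l ++ [a]`.
[folklore] -/
theorem afterLast_concat_self (a : V) (l : List V) : afterLast a (l ++ [a]) = [] := by
  rw [afterLast, List.rtakeWhile_concat]
  simp

/-- **Loop erasure after appending one vertex.** If the new final vertex `u` already occurs in
`loopErase l`, the erasure of `l ++ [u]` is the prefix of `loopErase l` through (the unique
occurrence of) `u`; otherwise it is `loopErase l` followed by `u`. [folklore] -/
theorem loopErase_concat (l : List V) (u : V) :
    loopErase (l ++ [u]) =
      if u ∈ loopErase l then (loopErase l).takeWhile (fun x => decide (x ≠ u)) ++ [u]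
      else loopErase l ++ [u] := by
  suffices H : ∀ (n : ℕ) (l : List V), l.length ≤ n →
      loopErase (l ++ [u]) =
        if u ∈ loopErase l then (loopErase l).takeWhile (fun x => decide (x ≠ u)) ++ [u]
        else loopErase l ++ [u] from H l.length l le_rfl
  intro n
  induction n with
  | zero =>
    intro l hl
    obtain rfl : l = [] := List.eq_nil_of_length_eq_zero (Nat.le_zero.mp hl)
    simp
  | succ n ih =>
    intro l hl
    cases l with
    | nil => simp
    | cons a l' =>
      have hl' : l'.length ≤ n := by simpa using hl
      rw [List.cons_append, loopErase_cons, loopErase_cons]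
      by_cases hau : a = u
      · subst hau
        rw [afterLast_concat_self]
        simp
      · have hua : u ≠ a := fun h => hau h.symm
        rw [afterLast_concat_of_ne hua]
        have hlen : (afterLast a l').length ≤ n := (length_afterLast_le a l').trans hl'
        rw [ih (afterLast a l') hlen]
        have hmem : (u ∈ a :: loopErase (afterLast a l')) ↔ u ∈ loopErase (afterLast a l') := by
          simp [hua]
        by_cases hu : u ∈ loopErase (afterLast a l')
        · rw [if_pos hu, if_pos (hmem.2 hu)]
          simp [hau]
        · rw [if_neg hu, if_neg (fun h => hu (hmem.1 h))]
          simp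

/-- On a walk whose support has no repeated vertex, dropping until `u` leaves `u` followed by the
part of the support after the last (= only) occurrence of `u`. [folklore] -/
theorem support_dropUntil_eq_cons_afterLast {G : SimpleGraph V} {v w u : V} (p : G.Walk v w)
    (h : u ∈ p.support) (hn : p.support.Nodup) :
    (p.dropUntil u h).support = u :: afterLast u p.support := by
  have hsplit : p.support = (p.takeUntil u h).support ++ (p.dropUntil u h).support.tail := by
    conv_lhs => rw [← p.take_spec h]
    exact Walk.support_append _ _
  have hT : (p.takeUntil u h).support = [] ∨ (p.takeUntil u h).support.getLast? = some u := by
    right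
    rw [List.getLast?_eq_some_getLast (by simp)]
    simp
  have huT : u ∈ (p.takeUntil u h).support := Walk.end_mem_support _
  have hr : u ∉ (p.dropUntil u h).support.tail := by
    intro hu
    rw [hsplit] at hn
    exact (List.nodup_append.1 hn).2.2 u huT u hu rfl
  have hafter : afterLast u p.support = (p.dropUntil u h).support.tail := by
    conv_lhs => rw [hsplit]
    exact afterLast_append_of hT hr
  rw [hafter]
  exact (Walk.cons_tail_support _).symm

/-- **`bypass` = reverse ∘ `loopErase` ∘ reverse.** For every walk `ω`, the support of Mathlib's
`ω.bypass` is the reversal of the chronological loop erasure of the reversed vertex list of `ω`.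
[folklore] -/
theorem support_bypass_eq_reverse_loopErase_reverse {G : SimpleGraph V} {a b : V}
    (ω : G.Walk a b) : ω.bypass.support = (loopErase ω.support.reverse).reverse := by
  induction ω with
  | nil => simp [Walk.bypass]
  | cons ha p ih =>
    rename_i u v w
    simp only [Walk.bypass]
    set M : List V := loopErase p.support.reverse with hM
    have hsupp : p.bypass.support = M.reverse := ih
    have hrev : (Walk.cons ha p).support.reverse = p.support.reverse ++ [u] := by
      simp [Walk.support_cons]
    rw [hrev, loopErase_concat, ← hM]
    split_ifs with hs hm hm
    · rw [support_dropUntil_eq_cons_afterLast _ hs p.bypass_isPath.support_nodup, hsupp]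
      simp [afterLast, List.rtakeWhile]
    · exact absurd (by simpa [hsupp] using hs) hm
    · exact absurd hm (by simpa [hsupp] using hs)
    · simp [Walk.support_cons, hsupp]

/-- `bypass` of the reversed walk, as a vertex list: the reversal of the chronological loop
erasure of the walk itself. [folklore] -/
theorem support_bypass_reverse {G : SimpleGraph V} {a b : V} (ω : G.Walk a b) :
    ω.reverse.bypass.support = (loopErase ω.support).reverse := by
  rw [support_bypass_eq_reverse_loopErase_reverse, Walk.support_reverse, List.reverse_reverse]

end Bridge

end Literature.Probability.RandomPlanarGeometry
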